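import Summits.ResolutionOfSingularities.ResolutionOfSingularities.Theorems.HilbertSamuelEliminationSigmaMaxModificationsCorridor3SigmaTameLowLaws
import HarnessLib

/-!
# [OURS · L1 W4.2] σ-LAYER, TAME-LOW — `Corridor3SigmaTameLowEndGameLaw`: THE END-GAME WEIGHT LAW at ring level (RULING v3.14-51 (51C) item (iii)):
# in the chart of a point blow-up of the lineage point (`f₂ = f₁·t` in the child germ) the extended coefficient ideal is `(f₁^{w₁+w₂} · t^{w₂})`, its
# controlled transform is `(f₁^{w₁+w₂−c} · t^{w₂})` with `(f₁^c) · 𝔞′ = 𝔞·R′` — so the T-L6 reading axiom `IsPointChild D D′` HOLDS for any child datum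
# reading that controlled transform (`isPointChild_of_pointChart`), and the child weights are T-L5's `pointChildren` corner `(w₁+w₂−c, w₂)` (resp. `(w₁, w₁+w₂−c)`
# in the other chart, `(w₁+w₂−c, 0)` at a non-corner point where `t` became a unit); the CURVE step `{f₁ = 0}` (`c ≤ w₁`) is the same-germ identity
# `(f₁^c) · (f₁^{w₁−c} f₂^{w₂}) = 𝔞` (`coeff_eq_span_pow_mul_curveTransform`)
# (crux chain w42 `SigmaMaxModifications` stmt-ResolutionOfSingularities-18506 / conjunct `SigmaMaxModificationsCorridor3` stmt-ResolutionOfSingularities-19249;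
# res-L1-w42-plan-1 DESK WORD 19:51:29Z «then (iii) the end-game weight law», RULING v3.14-51 (51C); seat res-L1-type-o2 g9 = «res-type-067/068 SUCCESSOR»;
# `--supports stmt-ResolutionOfSingularities-19249 --as helper`, counted 0)

HONEST FRAMING. OURS bookkeeping over this seat's FILE 1b (`CoeffDatum.EndFrame`, `coeff_eq_span`) and T-L6 (`IsPointChild`, `extIdeal_span_singleton_mul`),
elementary identities in the fraction field `K`; every `theorem` PROVED, no `def`, no named fact, no axiom. What stays the REALISATION's: that the child germ IS a
quadratic transform with the stated r.s.p. `(f₁, t)` / `(t, f₂)` / `(f₁, t − α)` (tree `QuadraticTransformsChart` / `BlowupChartRsop`), and that its Lipman data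
are `(𝔪on′·g′, 𝔞♮′ = ⊤)` — hypotheses here, exactly as in T-L6. NOTHING here is a statement of H. Hironaka's manuscript [Hironaka2017] nor of
Cossart–Jannsen–Saito. AI-typed; AI review weaker than expert review.

## Contents (namespace `…Theorems.SigmaMaxModificationsCorridor3.Sigma.TameLow`)

* §1 `extIdeal_span_singleton` (`(a)·S = (ι a)`) and the CURVE STEP: `EndFrame.coeff_eq_span_pow_mul_curveTransform₁/₂`
  (`𝔞 = (f₁^c) · (f₁^{w₁−c} f₂^{w₂})` for `c ≤ w₁`; symmetric) — the controlled transform of a legal curve move lives in the same germ with T-L5's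
  `curveChild` weights `(w₁ − c, w₂)` / `(w₁, w₂ − c)`.
* §2 POINT STEP, chart `f₁` (`f₂ = f₁ · t` in an over-germ `R′ ≥ R` inside `K`): `EndFrame.extIdeal_coeff_eq_of_chart₁`
  (`𝔞·R′ = ((ι f₁)^{w₁+w₂} · t^{w₂})`), `EndFrame.span_pow_mul_pointTransform₁` (`((ι f₁)^c) · ((ι f₁)^{w₁+w₂−c} · t^{w₂}) = 𝔞·R′` for `c ≤ w₁ + w₂`, the legal
  point move), and symmetric `…_of_chart₂` / `…pointTransform₂` (`f₁ = t · f₂`).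
* §3 **`EndFrame.isPointChild_of_pointChart₁/₂`** — for ANY child datum `D′` whose germ is a quadratic transform of `D.R` containing such a `t` and whose
  coefficient ideal reads the controlled transform `((ι f₁)^{w₁+w₂−c} · t^{w₂})` (resp. chart 2), the T-L6 reading axiom `IsPointChild D D′` HOLDS (witness
  `a = (ι f₁)^c`, `b = 1`); `pointChild_weights_fuel_lt` — the child weights `(w₁+w₂−c, w₂)`, `(w₁, w₁+w₂−c)`, `(w₁+w₂−c, 0)` are EXACTLY the three cases of
  T-L5's `TameLowCorner.fuel_point_lt` (so the end-game `fuel` drops), restated on `F.toCorner`.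

VACUITY SELF-CHECK. §1/§2 are identities with content (they fail if `f₂ ≠ f₁ t`); §3's hypotheses are satisfiable (the honest quadratic-transform chart) and its
conclusion is T-L6's non-trivial reading axiom.
-/

noncomputable section

set_option linter.dupNamespace false -- mandated namespace of this single-conjunct summit

open IsLocalRing Literature.AlgebraicGeometry.Resolution

namespace Summit.ResolutionOfSingularities.ResolutionOfSingularities.Theorems.SigmaMaxModificationsCorridor3.Sigma.TameLow

universe u

section Ext

variable {K : Type u} [Field K]

/-- `extIdeal` of a principal ideal is principal on the image. [folklore] -/
theorem extIdeal_span_singleton {R S : Subring K} (h : R ≤ S) (a : R) : extIdeal (Ideal.span {a}) S = Ideal.span {Subring.inclusion h a} := by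
  rw [extIdeal_eq_map _ h, Ideal.map_span, Set.image_singleton]

end Ext

namespace CoeffDatum

namespace EndFrame

variable {K : Type u} [Field K] {D : CoeffDatum K} (F : D.EndFrame)

/-! ## §1. The curve step (same germ) -/

/-- **CURVE STEP `{f₁ = 0}` (legal: `c ≤ w₁`): `𝔞 = (f₁^c) · (f₁^{w₁−c} · f₂^{w₂})`** — the controlled transform of the curve move is the second factor, in
the SAME germ (the blow-up of a curve on the surface is an isomorphism), with T-L5's `curveChild` weights `(w₁ − c, w₂)`. [folklore] -/
theorem coeff_eq_span_pow_mul_curveTransform₁ (hc : D.c ≤ F.w₁) :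
    D.coeff = Ideal.span {F.f₁ ^ D.c} * Ideal.span {F.f₁ ^ (F.w₁ - D.c) * F.f₂ ^ F.w₂} := by
  rw [F.coeff_eq_span, Ideal.span_singleton_mul_span_singleton, ← mul_assoc, ← pow_add, Nat.add_sub_cancel' hc]

/-- **CURVE STEP `{f₂ = 0}` (legal: `c ≤ w₂`)**, symmetric. [folklore] -/
theorem coeff_eq_span_pow_mul_curveTransform₂ (hc : D.c ≤ F.w₂) :
    D.coeff = Ideal.span {F.f₂ ^ D.c} * Ideal.span {F.f₁ ^ F.w₁ * F.f₂ ^ (F.w₂ - D.c)} := by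
  rw [F.coeff_eq_span, Ideal.span_singleton_mul_span_singleton, mul_left_comm, ← pow_add, Nat.add_sub_cancel' hc]

/-! ## §2. The point step in the two charts -/

section Chart

variable {R' : Subring K} (h : D.R ≤ R')

/-- In chart `f₁` (`f₂ = f₁ · t` in `R′`): `(ι f₁)^{w₁} (ι f₂)^{w₂} = (ι f₁)^{w₁+w₂} · t^{w₂}`. [folklore] -/
theorem inclusion_monomial_eq_of_chart₁ {t : R'} (ht : Subring.inclusion h F.f₂ = Subring.inclusion h F.f₁ * t) :
    Subring.inclusion h (F.f₁ ^ F.w₁ * F.f₂ ^ F.w₂) = Subring.inclusion h F.f₁ ^ (F.w₁ + F.w₂) * t ^ F.w₂ := by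
  rw [map_mul, map_pow, map_pow, ht, mul_pow, pow_add]
  ring

/-- **POINT STEP, chart `f₁`: the extended coefficient ideal is `((ι f₁)^{w₁+w₂} · t^{w₂})`.** [folklore] -/
theorem extIdeal_coeff_eq_of_chart₁ {t : R'} (ht : Subring.inclusion h F.f₂ = Subring.inclusion h F.f₁ * t) :
    extIdeal D.coeff R' = Ideal.span {Subring.inclusion h F.f₁ ^ (F.w₁ + F.w₂) * t ^ F.w₂} := by
  rw [F.coeff_eq_span, extIdeal_span_singleton h, F.inclusion_monomial_eq_of_chart₁ h ht]

/-- **POINT STEP, chart `f₁`, CONTROLLED TRANSFORM** (legal point move: `c ≤ w₁ + w₂`): `((ι f₁)^c) · ((ι f₁)^{w₁+w₂−c} · t^{w₂}) = 𝔞·R′` — the child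
weights at the chart's corner are T-L5's `pointChildren` corner `(w₁ + w₂ − c, w₂)` on the rays (exceptional `ρ = V(f₁)`, strict transform `V(t)` of
`{f₂ = 0}`). [folklore] -/
theorem span_pow_mul_pointTransform₁ {t : R'} (ht : Subring.inclusion h F.f₂ = Subring.inclusion h F.f₁ * t) (hc : D.c ≤ F.w₁ + F.w₂) :
    Ideal.span {Subring.inclusion h F.f₁ ^ D.c} * Ideal.span {Subring.inclusion h F.f₁ ^ (F.w₁ + F.w₂ - D.c) * t ^ F.w₂} = extIdeal D.coeff R' := by
  rw [F.extIdeal_coeff_eq_of_chart₁ h ht, Ideal.span_singleton_mul_span_singleton, ← mul_assoc, ← pow_add, Nat.add_sub_cancel' hc]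

/-- In chart `f₂` (`f₁ = t · f₂` in `R′`): `(ι f₁)^{w₁} (ι f₂)^{w₂} = t^{w₁} · (ι f₂)^{w₁+w₂}`. [folklore] -/
theorem inclusion_monomial_eq_of_chart₂ {t : R'} (ht : Subring.inclusion h F.f₁ = t * Subring.inclusion h F.f₂) :
    Subring.inclusion h (F.f₁ ^ F.w₁ * F.f₂ ^ F.w₂) = t ^ F.w₁ * Subring.inclusion h F.f₂ ^ (F.w₁ + F.w₂) := by
  rw [map_mul, map_pow, map_pow, ht, mul_pow, pow_add]
  ring

/-- **POINT STEP, chart `f₂`: the extended coefficient ideal is `(t^{w₁} · (ι f₂)^{w₁+w₂})`.** [folklore] -/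
theorem extIdeal_coeff_eq_of_chart₂ {t : R'} (ht : Subring.inclusion h F.f₁ = t * Subring.inclusion h F.f₂) :
    extIdeal D.coeff R' = Ideal.span {t ^ F.w₁ * Subring.inclusion h F.f₂ ^ (F.w₁ + F.w₂)} := by
  rw [F.coeff_eq_span, extIdeal_span_singleton h, F.inclusion_monomial_eq_of_chart₂ h ht]

/-- **POINT STEP, chart `f₂`, CONTROLLED TRANSFORM** (`c ≤ w₁ + w₂`): `((ι f₂)^c) · (t^{w₁} · (ι f₂)^{w₁+w₂−c}) = 𝔞·R′` — child weights
`(w₁, w₁ + w₂ − c)`. [folklore] -/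
theorem span_pow_mul_pointTransform₂ {t : R'} (ht : Subring.inclusion h F.f₁ = t * Subring.inclusion h F.f₂) (hc : D.c ≤ F.w₁ + F.w₂) :
    Ideal.span {Subring.inclusion h F.f₂ ^ D.c} * Ideal.span {t ^ F.w₁ * Subring.inclusion h F.f₂ ^ (F.w₁ + F.w₂ - D.c)} = extIdeal D.coeff R' := by
  rw [F.extIdeal_coeff_eq_of_chart₂ h ht, Ideal.span_singleton_mul_span_singleton, mul_left_comm, ← pow_add, Nat.add_sub_cancel' hc]

end Chart

/-! ## §3. The T-L6 reading axiom `IsPointChild` holds in the charts -/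

/-- **`IsPointChild D D′` FROM THE CHART, chart `f₁`**: if the child germ `D′.R` is a quadratic transform of `D.R` containing `t` with `f₂ = f₁ · t`, and its
coefficient ideal READS the controlled transform `((ι f₁)^{w₁+w₂−c} · t^{w₂})` of the legal point move (`c ≤ w₁ + w₂`), then T-L6's reading axiom holds
(witness `a = (ι f₁)^c`, `b = 1`) — hence the base-point phase / fuel bookkeeping of `…TameLowLaws` applies to this child. [folklore] -/
theorem isPointChild_of_pointChart₁ {D' : CoeffDatum K} (hq : IsQuadraticTransform D.R D'.R) {t : D'.R}
    (ht : Subring.inclusion hq.dominates.1 F.f₂ = Subring.inclusion hq.dominates.1 F.f₁ * t) (hc : D.c ≤ F.w₁ + F.w₂)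
    (hcoeff : D'.coeff = Ideal.span {Subring.inclusion hq.dominates.1 F.f₁ ^ (F.w₁ + F.w₂ - D.c) * t ^ F.w₂}) : IsPointChild D D' := by
  refine ⟨hq, Subring.inclusion hq.dominates.1 F.f₁ ^ D.c, 1, ?_, one_ne_zero, ?_⟩
  · exact pow_ne_zero _ (inclusion_ne_zero hq.dominates.1 F.f₁_ne_zero)
  · rw [hcoeff, Ideal.span_singleton_one, Ideal.top_mul, F.span_pow_mul_pointTransform₁ hq.dominates.1 ht hc]

/-- **`IsPointChild D D′` FROM THE CHART, chart `f₂`** (symmetric). [folklore] -/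
theorem isPointChild_of_pointChart₂ {D' : CoeffDatum K} (hq : IsQuadraticTransform D.R D'.R) {t : D'.R}
    (ht : Subring.inclusion hq.dominates.1 F.f₁ = t * Subring.inclusion hq.dominates.1 F.f₂) (hc : D.c ≤ F.w₁ + F.w₂)
    (hcoeff : D'.coeff = Ideal.span {t ^ F.w₁ * Subring.inclusion hq.dominates.1 F.f₂ ^ (F.w₁ + F.w₂ - D.c)}) : IsPointChild D D' := by
  refine ⟨hq, Subring.inclusion hq.dominates.1 F.f₂ ^ D.c, 1, ?_, one_ne_zero, ?_⟩
  · exact pow_ne_zero _ (inclusion_ne_zero hq.dominates.1 F.f₂_ne_zero)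
  · rw [hcoeff, Ideal.span_singleton_one, Ideal.top_mul, F.span_pow_mul_pointTransform₂ hq.dominates.1 ht hc]

/-- **The chart children's weights are T-L5's three point-children**: at a legal POINT move (`w₁ < c`, `w₂ < c`, `c ≤ w₁ + w₂`) the corner child of chart
`f₁` has weights `(w₁ + w₂ − c, w₂)`, the corner child of chart `f₂` has `(w₁, w₁ + w₂ − c)`, a non-corner child (where `t` became a unit) has
`(w₁ + w₂ − c, 0)` — and in all three the weight sum DROPS below `F.toCorner.fuel` (s42's `TameLowCorner.fuel_point_lt`, restated on the end-frame's
corner). [folklore] -/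
theorem pointChild_weights_fuel_lt (h₁ : F.w₁ < D.c) (h₂ : F.w₂ < D.c) (hc : D.c ≤ F.w₁ + F.w₂) :
    (F.w₁ + F.w₂ - D.c) + F.w₂ < F.toCorner.fuel ∧ F.w₁ + (F.w₁ + F.w₂ - D.c) < F.toCorner.fuel ∧ (F.w₁ + F.w₂ - D.c) + 0 < F.toCorner.fuel :=
  F.toCorner.fuel_point_lt h₁ h₂ hc

/-- Likewise the curve children's weights (`(w₁ − c, w₂)`, `(w₁, w₂ − c)`) drop the weight sum (s42's `fuel_curve₁_lt` / `fuel_curve₂_lt`). [folklore] -/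
theorem curveChild_weights_fuel_lt :
    (D.c ≤ F.w₁ → (F.w₁ - D.c) + F.w₂ < F.toCorner.fuel) ∧ (D.c ≤ F.w₂ → F.w₁ + (F.w₂ - D.c) < F.toCorner.fuel) :=
  ⟨F.toCorner.fuel_curve₁_lt, F.toCorner.fuel_curve₂_lt⟩

end EndFrame

end CoeffDatum

end Summit.ResolutionOfSingularities.ResolutionOfSingularities.Theorems.SigmaMaxModificationsCorridor3.Sigma.TameLow

end
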